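import Summits.HodgeConjecture.HodgeConjecture.Theorems.Ring2WeilCoverageTypeRelativeNormSignLevel39
import Summits.HodgeConjecture.HodgeConjecture.Theorems.Ring2WeilCoverageNonPrincipalLatticeLevel39
import Summits.HodgeConjecture.HodgeConjecture.Theorems.Ring2WeilCoverageLatticeTypeExchange
import HarnessLib

/-!
# Weil-type family coverage — THE RELATIVE NORM-SIGN LAW ON THE NON-PRINCIPAL LATTICE CLASS OF `ℤ[ζ₃₉]`: on
# `ℂ^Φ/Φ(𝔔)`, `𝔔 = (1 − ζ³, 4 + ζ¹³)`, the principal type `(ϖ₀)` occurs iff at EACH real place of `ℚ(√13)` the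
# twisted sign count of `Φ` is even exactly when the relative norm `N_{ℚ(ζ₃₉)⁺/ℚ(√13)}(ϖ₀)` is NEGATIVE there —
# part 58c's law with both signs FLIPPED

research route conditional on HC_CM; not a corollary; Q11.4-sentence-2 already refuted in dim ≥ 3.

Ring 2, WEIL-TYPE FAMILY-COVERAGE CENSUS (`HOME/WEIL-FAMILY-COVERAGE.md` `## b01`, blocks b01.39/b01.40 (the index-`2`
level `39`, `h(ℚ(ζ₃₉)) = 2`: principal polarisability FLIPS between the two lattice classes), b01.42 (the norm-sign law),
b01.44; owner ring2-b01), part 69 of the `Ring2WeilCoverage*` series.  Part 58c (`…TypeRelativeNormSignLevel39`)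
decided every principal type `(ϖ₀)` on the PRINCIPAL torus `ℂ^Φ/Φ(ℤ[ζ₃₉])`; part 45 (`…NonPrincipalLatticeLevel39`)
decided principal polarisations on the NON-principal class `𝔔` (`𝔔𝔔^ρ = (α)`, `α = ζ¹⁷(1 − ζ²)(1 − ζ⁴²) ∈ ℤ[ζ₃₉]⁺`);
part 59 (`…LatticeTypeExchange`) moves types between lattices: «type `(ϖ₀)` on `D(𝔪)`» ⟺ «type `(α₀ϖ₀)` on
`D(𝔬)`» when `𝔪𝔪^ρ = (α₀)`.  This file composes the three:

* §1 (any CM field) `re_relNorm_mul` — the relative norm read at a place is multiplicative on `𝓞 K⁺`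
  (`Re (zw) = Re z·Re w` for real `z, w`); `re_relNorm_ne_zero` (part 34's product formula).
* §2 `re_relNorm_alpha_neg` — **`N_{ℚ(ζ₃₉)⁺/ℚ(√13)}(α)` is NEGATIVE at BOTH real places of `ℚ(√13)`**: at the place under
  `φ₀` its sign is the parity of `#{φ ∈ Φ : φ(√13) = φ₀(√13), Re φ(α) < 0}` (part 58), and this count is `3` for every
  CM type `Φ` (part 45 `card_filter_negA_plus/minus`, through the residue dictionaries of parts 13/26b).
* §3 **`exists_type_span_iff_thirtyNine_nonprincipal`** — for every CM type `Φ`, every `ϖ₀ ∈ 𝓞 K⁺ ∖ 0` and every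
  lattice `𝔪 = 𝔔`: `ℂ^Φ/D(𝔪)` carries a `Φ`-positive divisor of type `(ϖ₀)` iff
  (`#{φ ∈ Φ : φ(s) = φ₊(s), Im φ(ξ) < 0}` even ⟺ `Re φ₊(N_{K⁺/ℚ(s)}(ϖ₀)) < 0`) and (the same at `φ₋`) — where part 58c
  has `> 0` twice for the principal lattice.  In words: passing from `ℤ[ζ₃₉]` to `𝔔` flips the verdict for EVERY
  principal type, not only for principal polarisations (b01.40).

HONEST FRAMING: torus-level statements about Shimura's divisors of type `(K; Φ; 𝔣₀)` [Sh98 §14.3 Prop. 4–5, §14.4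
Prop. 7]; nothing here is a statement about Hodge classes, `W_K`, general members or HC; `HC_CM` is used nowhere.  No
`def`, no named fact, no `sorry`.

References: [cite: Shimura1998, §14.3 Prop. 4–5, pp. 103–104; §14.4 Prop. 7, p. 105]; census b01.40, b01.44
(seat-derived).
-/

noncomputable section

open scoped Classical nonZeroDivisors NumberField ComplexConjugate
open NumberField NumberField.ComplexEmbedding Module FractionalIdeal Complex Polynomial Finset IntermediateField

namespace Summit.HodgeConjecture.Ring2WeilCoverage.TypeRelativeNormSignLevel39NonPrincipal

open Literature.AlgebraicGeometry.Motives (CMType)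
open Literature.AlgebraicGeometry.HodgeTheory (IsCMTypeSet)
open Literature.AlgebraicGeometry.ComplexMultiplication.CyclotomicCMType
  (exists_apply_eq_toCircle embedding_eq_of_apply_eq isCMTypeSet_residueFilter)
open Literature.NumberTheory.ComplexMultiplication
open Literature.NumberTheory.ComplexMultiplication.CMTypeLattice
open Summit.HodgeConjecture.Ring2WeilCoverage.CMTypeSignParity
open Summit.HodgeConjecture.Ring2WeilCoverage.CMUnitSignature
open Summit.HodgeConjecture.Ring2WeilCoverage.TypeNormSign
open Summit.HodgeConjecture.Ring2WeilCoverage.TypeRelativeNormSign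
open Summit.HodgeConjecture.Ring2WeilCoverage.TypeRelativeNormSignLevel39 (exists_type_span_iff_thirtyNine)
open Summit.HodgeConjecture.Ring2WeilCoverage.TwistedUnitSignature (prod_filter_re_embedding_eq_re_norm)
open Summit.HodgeConjecture.Ring2WeilCoverage.CyclotomicTwistedObstruction (apply_eq_apply_iff)
open Summit.HodgeConjecture.Ring2WeilCoverage.CyclotomicTwistedLevel39 (sq_gaussThirteen classes_thirtyNine)
open Summit.HodgeConjecture.Ring2WeilCoverage.ResidueDictionaryPiecesB (re_embedding_sqrtThirteen_neg_iff)
open Summit.HodgeConjecture.Ring2WeilCoverage.WeilTypeBalance (ncard_inter_eq_card_filter)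
open Summit.HodgeConjecture.Ring2WeilCoverage.CyclotomicPrincipalObstruction (coprime_of_apply_eq_toCircle)
open Summit.HodgeConjecture.Ring2WeilCoverage.NonPrincipalLatticeLevel39
  (alpha_read' alpha_real_ne_zero card_filter_negA_plus card_filter_negA_minus mul_conjIdeal_eq_of_coe_eq)
open Summit.HodgeConjecture.Ring2WeilCoverage.LatticeTypeExchange (exists_pos_isOfType_span_iff_one_span_mul)

variable {K : Type} [Field K] [NumberField K] [IsCMField K] {ζ : K}

/-- `𝐞(t) = exp(2πi t/39) ∈ ℂ` (`ZMod.toCircle`). -/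
local notation3 (prettyPrint := false) "𝐞 " t:max => ((ZMod.toCircle t : Circle) : ℂ)

/-- part 32's reference skew element `ξ = ζ¹¹/Φ₃₉′(ζ)` (`g = 12`). -/
local notation3 (prettyPrint := false) "ξ" => (ζ ^ 11 * (aeval ζ (derivative (cyclotomic 39 ℚ)))⁻¹)

/-- the image in `K` of an integer of the maximal real subfield. -/
local notation3 (prettyPrint := false) "𝓇 " x:max => (algebraMap (𝓞 (maximalRealSubfield K)) K x)

/-- `Re φ₀|_{K⁺}(N_{K⁺/ℚ(s)}(x))`. -/
local notation3 (prettyPrint := false) "RN[" φ₀ "," s "] " x:max =>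
  (((RingHom.comp (φ₀ : K →+* ℂ) (algebraMap (maximalRealSubfield K) K))
    (algebraMap (ℚ⟮(s : maximalRealSubfield K)⟯) (maximalRealSubfield K)
      (Algebra.norm (ℚ⟮(s : maximalRealSubfield K)⟯) (x : maximalRealSubfield K)))).re)

/-- «`t` is a non-residue mod `13`» (`χ₁₃(t) = −1`), part 26b's dictionary predicate for `√13`. -/
local notation3 (prettyPrint := false) "NR13 " t:max =>
  (({1, 3, 4, 9, 10, 12} : Finset (ZMod 13)).image (· * (((ZMod.val t : ℕ) : ℕ) : ZMod 13)) =
    ({2, 5, 6, 7, 8, 11} : Finset (ZMod 13)))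

/-- the class `C₊ = {t : χ₁₃(t) = +1}` of unit residues mod `39`. -/
local notation3 (prettyPrint := false) "Cp" => ({1, 4, 10, 14, 16, 17, 22, 23, 25, 29, 35, 38} : Finset (ZMod 39))

/-- `√13 ∈ ℚ(ζ₃₉)` as part 26b writes it. -/
local notation3 (prettyPrint := false) "S13" =>
  ((1 : K) + 2 * (ζ ^ (39 / 13) + ζ ^ (39 / 13 * 3) + ζ ^ (39 / 13 * 4) + ζ ^ (39 / 13 * 9) + ζ ^ (39 / 13 * 10) +
    ζ ^ (39 / 13 * 12)))

/-- the sign predicate of `α`: `39 < 2t mod 78 ↔ 39 < 42t mod 78` (part 45). -/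
local notation3 (prettyPrint := false) "negA " t:max =>
  (39 < 2 * ZMod.val (t : ZMod 39) % (2 * 39) ↔ 39 < 42 * ZMod.val (t : ZMod 39) % (2 * 39))

/-- `α = ζ¹⁷(1 − ζ²)(1 − ζ⁴²)` (part 45: `𝔔𝔔^ρ = (α)`). -/
local notation3 (prettyPrint := false) "α" => (ζ ^ 17 * (1 - ζ ^ 2) * (1 - ζ ^ 42))

/-- the lattice `𝔔 = (1 − ζ³, 4 + ζ¹³) ⊂ 𝓞 K` (part 45). -/
local notation3 (prettyPrint := false) "𝔔[" hζ "]" =>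
  (Ideal.span {1 - IsPrimitiveRoot.toInteger hζ ^ 3, 4 + IsPrimitiveRoot.toInteger hζ ^ 13} : Ideal (𝓞 K))

/-! ### §1 The relative norm read at a place is multiplicative and non-vanishing -/

/-- **`RN[φ₀, s](xy) = RN[φ₀, s](x)·RN[φ₀, s](y)`** for `x, y ∈ 𝓞 K⁺` (the relative norm, the two algebra maps and
`φ₀` are multiplicative, and `Re (zw) = Re z · Re w` for the REAL complex numbers `z, w` — images of elements of `K⁺`).
research route conditional on HC_CM; not a corollary; Q11.4-sentence-2 already refuted in dim ≥ 3. [folklore] -/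
theorem re_relNorm_mul (s : maximalRealSubfield K) (φ₀ : K →+* ℂ) (x y : 𝓞 (maximalRealSubfield K)) :
    ((RingHom.comp (φ₀ : K →+* ℂ) (algebraMap (maximalRealSubfield K) K))
      (algebraMap (ℚ⟮(s : maximalRealSubfield K)⟯) (maximalRealSubfield K)
        (Algebra.norm (ℚ⟮(s : maximalRealSubfield K)⟯)
          ((x * y : 𝓞 (maximalRealSubfield K)) : maximalRealSubfield K)))).re =
      RN[φ₀, s] x * RN[φ₀, s] y := by
  have hre : ∀ (a : maximalRealSubfield K),
      ((RingHom.comp (φ₀ : K →+* ℂ) (algebraMap (maximalRealSubfield K) K)) a).im = 0 := fun a =>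
    im_embedding_eq_zero_of_complexConj_eq (IsCMField.complexConj_apply_eq_self K a) φ₀
  rw [show ((x * y : 𝓞 (maximalRealSubfield K)) : maximalRealSubfield K) =
      (x : maximalRealSubfield K) * (y : maximalRealSubfield K) from rfl]
  simp only [map_mul, Complex.mul_re, hre, mul_zero, sub_zero]

/-- **`RN[φ₀, s](x) ≠ 0`** for `x ∈ 𝓞 K⁺ ∖ 0` (a product of non-zero real parts of real non-zero conjugates).
research route conditional on HC_CM; not a corollary; Q11.4-sentence-2 already refuted in dim ≥ 3. [folklore] -/
theorem re_relNorm_ne_zero (Φ : CMType K) (s : maximalRealSubfield K) (φ₀ : K →+* ℂ)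
    {x : 𝓞 (maximalRealSubfield K)} (hx : x ≠ 0) : RN[φ₀, s] x ≠ 0 := by
  rw [← prod_filter_re_embedding_eq_re_norm Φ s ((x : 𝓞 (maximalRealSubfield K)) : maximalRealSubfield K) φ₀,
    Finset.prod_ne_zero_iff]
  intro φ _
  rw [← IsScalarTower.algebraMap_apply (𝓞 (maximalRealSubfield K)) (maximalRealSubfield K) K]
  exact re_embedding_ne_zero_of_real (complexConj_algebraMap_ringOfIntegers x) (algebraMap_ringOfIntegers_ne_zero hx)
    φ.1

/-! ### §2 The relative norm of `α` is negative at both places -/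

variable [IsCyclotomicExtension {39} ℚ K]

/-- **`Re φ₀(N_{K⁺/ℚ(√13)}(α)) < 0` at EVERY place**: for any CM type `Φ` and any embedding `φ₀`, the number of `φ ∈ Φ`
over the place of `φ₀` with `Re φ(α) < 0` is `3` (part 45's counts `|S_Φ ∩ C± ∩ {negA}| = 3` through the dictionaries
`Re φ_t(α) < 0 ↔ negA t` and `φ_t(√13) = φ₀(√13) ↔ (χ₁₃(t) = χ₁₃(t₀))`), hence odd, so the relative norm is not positive
(part 58 `re_relNorm_pos_iff_even_ncard_on`) and it is non-zero.
research route conditional on HC_CM; not a corollary; Q11.4-sentence-2 already refuted in dim ≥ 3. [cite: Shimura1998, §14.3 Prop. 4–5, pp. 103–104] -/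
theorem re_relNorm_alpha_neg (hζ : IsPrimitiveRoot ζ 39) (Φ : CMType K) (s : maximalRealSubfield K)
    (hs : (s : K) = S13) (φ₀ : K →+* ℂ) {α₀ : 𝓞 (maximalRealSubfield K)} (hα₀ : 𝓇 α₀ = α) :
    RN[φ₀, s] α₀ < 0 := by
  classical
  have hα0 : α₀ ≠ 0 := by
    intro h
    rw [h, map_zero] at hα₀
    exact (alpha_real_ne_zero hζ).2 hα₀.symm
  -- the dictionary for `√13`
  have hη : IsPrimitiveRoot (ζ ^ 3) 13 := hζ.pow (by norm_num) (by norm_num)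
  have hs2 : (S13 : K) ^ 2 = ((13 : ℕ) : K) := by
    have := sq_gaussThirteen hη
    have e : (1 : K) + 2 * (ζ ^ (39 / 13) + ζ ^ (39 / 13 * 3) + ζ ^ (39 / 13 * 4) + ζ ^ (39 / 13 * 9) +
        ζ ^ (39 / 13 * 10) + ζ ^ (39 / 13 * 12)) =
        1 + 2 * (ζ ^ 3 + (ζ ^ 3) ^ 3 + (ζ ^ 3) ^ 4 + (ζ ^ 3) ^ 9 + (ζ ^ 3) ^ 10 + (ζ ^ 3) ^ 12) := by norm_num; ring
    rw [e, this]; norm_num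
  have hdict : ∀ {φ : K →+* ℂ} {t : ZMod 39}, φ ζ = 𝐞 t → t.val.Coprime 39 →
      ((((φ S13).re < 0 ↔ NR13 t) ∧ (φ S13).re ≠ 0) ∧ (φ S13).im = 0) :=
    fun hφ ht => re_embedding_sqrtThirteen_neg_iff (n := 39) (by norm_num) hφ ht
  obtain ⟨t₀, ht₀, hφ₀⟩ := exists_apply_eq_toCircle hζ φ₀
  have hCp := classes_thirtyNine.1
  have hS := isCMTypeSet_residueFilter hζ Φ
  -- the count over the place of `φ₀`, in residues, is `3` on either class
  have hPQ : ∀ (φ : K →+* ℂ) (t : ZMod 39), φ ζ = 𝐞 t →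
      ((φ S13 = φ₀ S13 ∧ (φ α).re < 0) ↔ ((NR13 t ↔ NR13 t₀) ∧ negA t)) := by
    intro φ t hφ
    have ht : t.val.Coprime 39 := coprime_of_apply_eq_toCircle hζ hφ
    rw [apply_eq_apply_iff hs2 (fun t : ZMod 39 => NR13 t) hdict hφ ht hφ₀ ht₀, alpha_read' φ t ht hφ]
  have hcount : (Φ.1 ∩ {ψ : K →+* ℂ | ψ (s : K) = φ₀ (s : K) ∧ (ψ (𝓇 α₀)).re < 0}).ncard = 3 := by
    rw [hα₀, hs, ncard_inter_eq_card_filter hζ Φ (fun ψ => ψ S13 = φ₀ S13 ∧ (ψ α).re < 0)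
      (fun t => (NR13 t ↔ NR13 t₀) ∧ negA t) hPQ]
    by_cases h0 : NR13 t₀
    · refine Eq.trans ?_ (card_filter_negA_minus hS)
      congr 1
      ext t
      simp only [Finset.mem_filter, Finset.mem_inter, Finset.mem_univ, true_and]
      constructor
      · rintro ⟨hσ, hN, hA⟩
        obtain ⟨σ, hσΦ, hσt⟩ := hσ
        have ht : t.val.Coprime 39 := coprime_of_apply_eq_toCircle hζ hσt
        exact ⟨⟨⟨σ, hσΦ, hσt⟩, fun hC => ((hCp t ht).mp hC).mp (hN.mpr h0)⟩, hA⟩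
      · rintro ⟨⟨hσ, hC⟩, hA⟩
        obtain ⟨σ, hσΦ, hσt⟩ := hσ
        have ht : t.val.Coprime 39 := coprime_of_apply_eq_toCircle hζ hσt
        refine ⟨⟨σ, hσΦ, hσt⟩, ⟨fun _ => h0, fun _ => ?_⟩, hA⟩
        by_contra hN
        exact hC ((hCp t ht).mpr (iff_false_intro hN))
    · refine Eq.trans ?_ (card_filter_negA_plus hS)
      congr 1
      ext t
      simp only [Finset.mem_filter, Finset.mem_inter, Finset.mem_univ, true_and]
      constructor
      · rintro ⟨hσ, hN, hA⟩
        obtain ⟨σ, hσΦ, hσt⟩ := hσ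
        have ht : t.val.Coprime 39 := coprime_of_apply_eq_toCircle hζ hσt
        exact ⟨⟨⟨σ, hσΦ, hσt⟩, (hCp t ht).mpr (iff_false_intro fun hN' => h0 (hN.mp hN'))⟩, hA⟩
      · rintro ⟨⟨hσ, hC⟩, hA⟩
        obtain ⟨σ, hσΦ, hσt⟩ := hσ
        have ht : t.val.Coprime 39 := coprime_of_apply_eq_toCircle hζ hσt
        have hN : ¬ NR13 t := fun hN => ((hCp t ht).mp hC).mp hN
        exact ⟨⟨σ, hσΦ, hσt⟩, ⟨fun hN' => absurd hN' hN, fun h0' => absurd h0' h0⟩, hA⟩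
  -- hence not positive, and non-zero
  have hne := re_relNorm_ne_zero Φ s φ₀ hα0
  have hnot : ¬ 0 < RN[φ₀, s] α₀ := by
    rw [re_relNorm_pos_iff_even_ncard_on Φ s φ₀ hα0, hcount]
    decide
  exact lt_of_le_of_ne (not_lt.mp hnot) hne

/-! ### §3 The law on the non-principal class `𝔔` -/

/-- **THE RELATIVE NORM-SIGN LAW ON `ℂ^Φ/Φ(𝔔)` AT `39` (both signs flipped).**  For every CM type `Φ` of
`K ⊇ ℚ(ζ₃₉)`, every real `ϖ₀ ∈ 𝓞 K⁺ ∖ 0`, embeddings `φ₊`, `φ₋` reading the two real places of `ℚ(√13)`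
(`Re φ₊(s) > 0 > Re φ₋(s)`, `s = √13`), and every invertible lattice `𝔪` equal to `𝔔 = (1 − ζ³, 4 + ζ¹³)`:
**`ℂ^Φ/D(𝔪)` carries a `Φ`-positive divisor of type `(ϖ₀)` iff (`#{φ ∈ Φ : φ(s) = φ₊(s), Im φ(ξ) < 0}` even ⟺
`Re φ₊(N_{K⁺/ℚ(s)}(ϖ₀)) < 0`) and (`#{φ ∈ Φ : φ(s) = φ₋(s), Im φ(ξ) < 0}` even ⟺ `Re φ₋(N_{K⁺/ℚ(s)}(ϖ₀)) < 0`)** —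
part 58c's law on `ℤ[ζ₃₉]` read at the type `(αϖ₀)` (part 59, `𝔔𝔔^ρ = (α)`), with `N(α) < 0` at both places (§2).
research route conditional on HC_CM; not a corollary; Q11.4-sentence-2 already refuted in dim ≥ 3. [cite: Shimura1998, §14.3 Prop. 4–5, pp. 103–104; §14.4 Prop. 7, p. 105] -/
theorem exists_type_span_iff_thirtyNine_nonprincipal (hζ : IsPrimitiveRoot ζ 39) (Φ : CMType K)
    (s : maximalRealSubfield K) (hs : (s : K) = S13) {ϖ₀ : 𝓞 (maximalRealSubfield K)} (hϖ0 : ϖ₀ ≠ 0)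
    (φp φm : K →+* ℂ) (hp : 0 < (φp (s : K)).re) (hm : (φm (s : K)).re < 0)
    (𝔪 : (FractionalIdeal (𝓞 K)⁰ K)ˣ)
    (h𝔪 : (𝔪 : FractionalIdeal (𝓞 K)⁰ K) = ((𝔔[hζ] : Ideal (𝓞 K)) : FractionalIdeal (𝓞 K)⁰ K)) :
    (∃ ζ' : K, IsCMField.complexConj K ζ' = -ζ' ∧ (∀ φ : Φ.1, 0 < (φ.1 ζ').im) ∧
        IsOfType 𝔪 ζ' (Ideal.span {ϖ₀})) ↔
      ((Even ((Φ.1 ∩ {ψ : K →+* ℂ | ψ (s : K) = φp (s : K) ∧ (ψ ξ).im < 0}).ncard) ↔ RN[φp, s] ϖ₀ < 0) ∧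
        (Even ((Φ.1 ∩ {ψ : K →+* ℂ | ψ (s : K) = φm (s : K) ∧ (ψ ξ).im < 0}).ncard) ↔ RN[φm, s] ϖ₀ < 0)) := by
  -- `α` is the image of a non-zero real integer `α₀`
  have hαint : IsIntegral ℤ (α : K) := by
    have hz : IsIntegral ℤ ζ := hζ.isIntegral (by norm_num)
    exact ((hz.pow 17).mul (isIntegral_one.sub (hz.pow 2))).mul (isIntegral_one.sub (hz.pow 42))
  obtain ⟨α₀, hα₀⟩ := (IsCMField.RingOfIntegers.complexConj_eq_self_iff K (⟨α, hαint⟩ : 𝓞 K)).mp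
    (alpha_real_ne_zero hζ).1
  have hα₀' : 𝓇 α₀ = α := hα₀
  have hα0 : α₀ ≠ 0 := by
    intro h
    rw [h, map_zero] at hα₀'
    exact (alpha_real_ne_zero hζ).2 hα₀'.symm
  -- `𝔪𝔪^ρ = (α₀)` and the exchange of part 59
  have h𝔪' : (𝔪 : FractionalIdeal (𝓞 K)⁰ K) * (conjIdeal 𝔪 : FractionalIdeal (𝓞 K)⁰ K) =
      spanSingleton (𝓞 K)⁰ (𝓇 α₀) := by
    rw [hα₀']; exact mul_conjIdeal_eq_of_coe_eq hζ 𝔪 h𝔪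
  rw [exists_pos_isOfType_span_iff_one_span_mul Φ 𝔪 hα0 h𝔪' ϖ₀,
    exists_type_span_iff_thirtyNine hζ Φ s hs (mul_ne_zero hα0 hϖ0) φp φm hp hm,
    re_relNorm_mul s φp α₀ ϖ₀, re_relNorm_mul s φm α₀ ϖ₀]
  have hap := re_relNorm_alpha_neg hζ Φ s hs φp hα₀'
  have ham := re_relNorm_alpha_neg hζ Φ s hs φm hα₀'
  have hsign : ∀ {a b : ℝ}, a < 0 → (0 < a * b ↔ b < 0) := fun ha =>
    ⟨fun h => by
      by_contra hb
      exact absurd h (not_lt.mpr (mul_nonpos_of_nonpos_of_nonneg ha.le (not_lt.mp hb))),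
      fun hb => mul_pos_of_neg_of_neg ha hb⟩
  rw [hsign hap, hsign ham]

end Summit.HodgeConjecture.Ring2WeilCoverage.TypeRelativeNormSignLevel39NonPrincipal

end
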